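import Summits.Ventures.PercRepro.RankLevelSetExplicitLin2KeyCube

/-!
# PercRepro — THE CUBE KEY ROW AT `(q, p) = (16, 261 255)`, PART C: chunks 9 … 12 of 16 (p9, S4)

`proofs/SUBCLAIM-S4-p9.md` §S4.2⁗‴. The cube key `KeyC 16 261255 d` (RankLevelSetExplicitLin2KeyCube) at the coranks
`32785 … 49168` of the level-16 row at `p = 261 255`, by the kernel (`decide`, four chunks of
4 096); the row is assembled in RankLevelSetExplicitLin2CubeRowSixteen. Axioms: standard.
-/

namespace PercRepro

namespace ThmN

namespace Explicit

/-- The cube key row at `(q, p) = (16, 261 255)`, chunk 9 of 16: coranks `32785 … 36880`, by the kernel. -/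
theorem key_sixteen_cube_row_9 : ∀ t < 4096, KeyC 16 261255 (17 + (32768 + t)) := by decide +kernel

/-- The cube key row at `(q, p) = (16, 261 255)`, chunk 10 of 16: coranks `36881 … 40976`, by the kernel. -/
theorem key_sixteen_cube_row_10 : ∀ t < 4096, KeyC 16 261255 (17 + (36864 + t)) := by decide +kernel

/-- The cube key row at `(q, p) = (16, 261 255)`, chunk 11 of 16: coranks `40977 … 45072`, by the kernel. -/
theorem key_sixteen_cube_row_11 : ∀ t < 4096, KeyC 16 261255 (17 + (40960 + t)) := by decide +kernel

/-- The cube key row at `(q, p) = (16, 261 255)`, chunk 12 of 16: coranks `45073 … 49168`, by the kernel. -/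
theorem key_sixteen_cube_row_12 : ∀ t < 4096, KeyC 16 261255 (17 + (45056 + t)) := by decide +kernel

end Explicit

end ThmN

end PercRepro
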